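import Mathlib
import Literature.Computability.AlgebraicComplexity.IMMInVPProofs
import Literature.Computability.AlgebraicComplexity.ArithCircuitProofs
import HarnessLib

/-!
# Simulating a commutative coefficient algebra of finite dimension (Hrubeš–Yehudayoff 2011)

Let `k ⊆ R` be commutative rings, `R` a `k`-algebra which is FREE OF FINITE RANK as a `k`-module,
with basis `b : ι → R` (`|ι| = d`). A polynomial `F ∈ R[X_σ]` computed by an arithmetic circuit
OVER `R` (constants from `R`) of fan-in-two size `L_R(F)` can be simulated over `k`: every gate
value `v ∈ R[X]` is stored as its `d` coordinate polynomials `v_c ∈ k[X]` (`v = ∑_c v_c · b_c`),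
a sum gate `r • u + r' • u'` becomes `d` linear combinations of `2d` coordinates (through the
matrices of multiplication by `r, r'`), and a product gate `u · u'` becomes the `d` bilinear forms
`∑_{j,l} (b_j b_l)_c · u_j u'_l` in the coordinates (structure constants). Hence for every
`k`-linear functional `φ : R → k`, the polynomial `φ(F) ∈ k[X]` obtained by applying `φ`
COEFFICIENTWISE satisfies

  `L_k(φ(F)) ≤ (5d³ + 6d² + 2d) · L_R(F) + 3d`            (`CommExtSim.complexity_lmap_le`).

This is the commutative case of Hrubeš–Yehudayoff 2011, Thm 4.2 ("if `R'` is a ring extension of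
`R` with `dim_R(R') = k` then `C_R(f) ≤ O(k³) · C_{R'}(f)`"), there stated for `f` with
coefficients in the subring; reading off a functional `φ` is the form in which the bound is used
for twisted determinants (`Literature/…/CommTwistDim.lean`: the permanent is `φ` of one
determinant over a commutative algebra realising the sign character) and for
`(m, s)`-determinantal representations (`Literature/…/AlgDetRepr.lean`). Only polynomial
dependence on `d` matters downstream; no attempt is made at the sharp constant.

## The proof: substitution instead of circuit surgery

The tree's `complexity` is single-output, so the simulating circuit is not built gate by gate.
Instead (`§ The simulating substitutions`) we work in `k[X_σ, y_{j,c}]` with one fresh variable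
`y_{j,c}` per gate `j < N` and coordinate `c`, write the `c`-th coordinate of gate `t` as an
explicit small polynomial `gatePoly t g c` in the `X` and the `y_{j,·}`, `j < t`
(`opndPoly`, `prodPoly`), and starting from `∑_c φ(b_c) · (output)_c` substitute
`y_{t,c} ↦ gatePoly t g_t c` for `t = N-1, …, 0` (`substGate`, `substGates`), finally killing the
fresh variables (`readAt []`). Each substitution costs at most the total cost of the `d`
polynomials substituted (Bürgisser 2000, Rem. 2.7, tree: `complexity_aeval_le`), which is
`≤ 5d³ + 6d² + 2d` for a fan-in-two gate (`sum_complexity_gatePoly_le`). Correctness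
(`readAt_nil_comp_substGates`, by reverse induction on the gate list): killing the fresh
variables after all substitutions equals reading `y_{j,c} ↦` (coordinate `c` of the value of
gate `j`), because the coordinate polynomials compute coordinates (`readAt_gatePoly`, from the
bilinear expansion `lmap_coord_mul` of a product along the basis).

## Contents

* `CommExtSim.lmap φ F` — `φ` applied coefficientwise (an `abbrev` for Mathlib's
  `AddMonoidAlgebra.map φ`; cf. the bundled `Fin n`-variable version
  `Literature.AlgebraicGeometry.Motives.AffineDeRham.coeffwise`), with its coordinate calculus
  along a basis (`lmap_eq_sum_coord`, `eq_sum_C_mul_map_coord`, `lmap_coord_mul`,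
  `lmap_coord_smul`, `lmap_coord_X`, `lmap_coord_C`);
* the simulation data `yv`, `opndPoly`, `prodPoly`, `gatePoly`, `readAt`, `substGate`,
  `substGates`, `outPoly`, `simPoly`, their semantics (`simPoly_eq`) and cost
  (`complexity_simPoly_le`);
* the simulation theorem `CommExtSim.complexity_lmap_le`.

## Sources

* [HrubesYehudayoff2011] P. Hrubeš, A. Yehudayoff, *Arithmetic complexity in ring extensions*,
  Theory of Computing 7 (2011) 119–129, Thm 4.2 (commutative extensions of dimension `k` cost
  `O(k³)`), §2 (the model: circuits over `R'` computing a polynomial over `R`).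
* [Burgisser2000] P. Bürgisser, *Completeness and Reduction in Algebraic Complexity Theory*,
  Springer 2000, Def. 2.1 (the measure `L`), Rem. 2.7 (substitution).

## Design choices / not here

* `R` is assumed free with an explicit finite basis (over a field: `Module.finBasis`); the bound
  is in `|ι|`, so users instantiate with `Fin (finrank k R)`.
* The variable type `σ` of `F` must be a `Fintype` (the substitution bound sums over variables).
* Not here: the noncommutative case of Thm 4.2 (matrix coefficients), formula size, and the
  converse direction (Hrubeš–Yehudayoff Thm 3.4: commutative extensions do not help by more
  than a polynomial).
-/

noncomputable section

open MvPolynomial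

namespace Literature.Computability.AlgebraicComplexity

universe u v w x

namespace CommExtSim

variable {k : Type u} [CommRing k] {R : Type v} [CommRing R] [Algebra k R]
variable {σ : Type w}

/-! ### Coefficientwise image of a polynomial under a linear functional -/

/-- `lmap φ F`: apply the `k`-linear functional `φ : R → k` to every coefficient of
`F : MvPolynomial σ R` (this is `AddMonoidAlgebra.map φ`). [folklore] -/
abbrev lmap (φ : R →ₗ[k] k) (F : MvPolynomial σ R) : MvPolynomial σ k :=
  AddMonoidAlgebra.map φ.toAddMonoidHom F

/-- Coefficients of `lmap φ F`. [folklore] -/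
@[simp] theorem coeff_lmap (φ : R →ₗ[k] k) (F : MvPolynomial σ R) (m : σ →₀ ℕ) :
    coeff m (lmap φ F) = φ (coeff m F) := rfl

/-- `lmap φ` is additive. [folklore] -/
theorem lmap_add (φ : R →ₗ[k] k) (F G : MvPolynomial σ R) :
    lmap φ (F + G) = lmap φ F + lmap φ G := by
  ext m; simp

/-- `lmap φ 0 = 0`. [folklore] -/
theorem lmap_zero (φ : R →ₗ[k] k) : lmap φ (0 : MvPolynomial σ R) = 0 := by
  ext m; simp

/-- `lmap φ` commutes with finite sums. [folklore] -/
theorem lmap_sum {α : Type*} (φ : R →ₗ[k] k) (s : Finset α) (F : α → MvPolynomial σ R) :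
    lmap φ (∑ a ∈ s, F a) = ∑ a ∈ s, lmap φ (F a) := by
  ext m; simp [coeff_sum]

/-- `lmap φ` commutes with list sums. [folklore] -/
theorem lmap_list_sum (φ : R →ₗ[k] k) (l : List (MvPolynomial σ R)) :
    lmap φ l.sum = (l.map (lmap φ)).sum := by
  induction l with
  | nil => simp
  | cons a l ih => rw [List.sum_cons, lmap_add, ih, List.map_cons, List.sum_cons]

/-- The key computation: `lmap φ (C r * map (algebraMap k R) P) = φ r • P`. [folklore] -/
theorem lmap_C_mul_map (φ : R →ₗ[k] k) (r : R) (P : MvPolynomial σ k) :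
    lmap φ (C r * MvPolynomial.map (algebraMap k R) P) = φ r • P := by
  ext m
  rw [coeff_lmap, coeff_C_mul, coeff_map, coeff_smul, mul_comm, ← Algebra.smul_def, map_smul,
    smul_eq_mul, smul_eq_mul, mul_comm]

variable {ι : Type x} (b : Module.Basis ι k R)

/-- Coordinates of a variable. [folklore] -/
theorem lmap_coord_X (c : ι) (x : σ) :
    lmap (b.coord c) (X x : MvPolynomial σ R) = (b.repr 1 c) • X x := by
  have h : (X x : MvPolynomial σ R) = C 1 * MvPolynomial.map (algebraMap k R) (X x) := by
    rw [map_X, map_one, one_mul]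
  rw [h, lmap_C_mul_map, Module.Basis.coord_apply]

/-- Coordinates of a constant. [folklore] -/
theorem lmap_coord_C (c : ι) (r : R) :
    lmap (b.coord c) (C r : MvPolynomial σ R) = C (b.repr r c) := by
  have h : (C r : MvPolynomial σ R) = C r * MvPolynomial.map (algebraMap k R) 1 := by
    rw [map_one, mul_one]
  rw [h, lmap_C_mul_map, Module.Basis.coord_apply, smul_eq_C_mul, mul_one]

/-- Coordinates of `1`. [folklore] -/
theorem lmap_coord_one (c : ι) :
    lmap (b.coord c) (1 : MvPolynomial σ R) = C (b.repr 1 c) := by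
  rw [← C_1, lmap_coord_C]

variable [Fintype ι]

/-- Expansion of a functional along a basis: `lmap φ F = ∑ c, φ (b c) • lmap (b.coord c) F`.
[folklore] -/
theorem lmap_eq_sum_coord (φ : R →ₗ[k] k) (F : MvPolynomial σ R) :
    lmap φ F = ∑ c, φ (b c) • lmap (b.coord c) F := by
  ext m
  simp only [coeff_lmap, coeff_sum, coeff_smul, Module.Basis.coord_apply, smul_eq_mul]
  conv_lhs => rw [← b.sum_repr (coeff m F)]
  rw [map_sum]
  refine Finset.sum_congr rfl fun c _ => ?_
  rw [map_smul, smul_eq_mul, mul_comm]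

/-- Reconstruction of an `R`-polynomial from its coordinate polynomials:
`F = ∑ c, C (b c) * map (algebraMap k R) (lmap (b.coord c) F)`. [folklore] -/
theorem eq_sum_C_mul_map_coord (F : MvPolynomial σ R) :
    F = ∑ c, C (b c) * MvPolynomial.map (algebraMap k R) (lmap (b.coord c) F) := by
  ext m
  simp only [coeff_sum, coeff_C_mul, coeff_map, coeff_lmap, Module.Basis.coord_apply]
  conv_lhs => rw [← b.sum_repr (coeff m F)]
  refine Finset.sum_congr rfl fun c _ => ?_
  rw [Algebra.smul_def, mul_comm]

/-- Coordinates of a product: bilinear in the coordinates, through the structure constants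
`b.repr (b j * b l) c`. [folklore] -/
theorem lmap_coord_mul (c : ι) (F G : MvPolynomial σ R) :
    lmap (b.coord c) (F * G) =
      ∑ j, ∑ l, (b.repr (b j * b l) c) • (lmap (b.coord j) F * lmap (b.coord l) G) := by
  conv_lhs => rw [eq_sum_C_mul_map_coord b F, eq_sum_C_mul_map_coord b G, Finset.sum_mul_sum]
  rw [lmap_sum]
  refine Finset.sum_congr rfl fun j _ => ?_
  rw [lmap_sum]
  refine Finset.sum_congr rfl fun l _ => ?_
  have : C (b j) * MvPolynomial.map (algebraMap k R) (lmap (b.coord j) F) *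
      (C (b l) * MvPolynomial.map (algebraMap k R) (lmap (b.coord l) G)) =
      C (b j * b l) *
        MvPolynomial.map (algebraMap k R) (lmap (b.coord j) F * lmap (b.coord l) G) := by
    rw [map_mul, map_mul]; ring
  rw [this, lmap_C_mul_map, Module.Basis.coord_apply]

/-- Coordinates of an `R`-scalar multiple. [folklore] -/
theorem lmap_coord_smul (c : ι) (r : R) (F : MvPolynomial σ R) :
    lmap (b.coord c) (r • F) = ∑ l, (b.repr (r * b l) c) • lmap (b.coord l) F := by
  conv_lhs => rw [eq_sum_C_mul_map_coord b F, Finset.smul_sum]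
  rw [lmap_sum]
  refine Finset.sum_congr rfl fun l _ => ?_
  rw [smul_eq_C_mul, ← mul_assoc, ← map_mul, lmap_C_mul_map, Module.Basis.coord_apply]

/-! ### The simulating substitutions

Fix a circuit bound `N` (the number of gates of the circuit over `R` to be simulated). We work in
the polynomial ring over `k` in the variables `σ ⊕ (Fin N × ι)`: the original variables and one
fresh variable `y_{j,c}` for every gate `j < N` and every coordinate `c`. -/

section Circuit

open ArithCircuit

variable (N : ℕ)

/-- The fresh variable `y_{j,c}` standing for coordinate `c` of the value of gate `j`
(`0` if `j ≥ N`). [folklore] -/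
def yv (j : ℕ) (c : ι) : MvPolynomial (σ ⊕ (Fin N × ι)) k :=
  if h : j < N then X (Sum.inr (⟨j, h⟩, c)) else 0

/-- Coordinate `c` of an operand of gate number `t`, as a polynomial in the fresh variables:
`X x = (X x) • 1` has coordinates `(b.repr 1 c) • X x`, a constant `r` has coordinates
`b.repr r c`, and a reference to gate `j` reads `y_{j,c}` if `j < t` (junk references, `t ≤ j`,
evaluate to `0`). [folklore] -/
def opndPoly (t : ℕ) : Operand R σ → ι → MvPolynomial (σ ⊕ (Fin N × ι)) k
  | .var x, c => (b.repr 1 c) • X (Sum.inl x)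
  | .const r, c => C (b.repr r c)
  | .gate j, c => if j < t then yv N j c else 0

/-- Coordinate `c` of the product of a list of operands of gate `t` (bilinear expansion through
the structure constants, one factor at a time). [folklore] -/
def prodPoly (t : ℕ) : List (Operand R σ) → ι → MvPolynomial (σ ⊕ (Fin N × ι)) k
  | [], c => C (b.repr 1 c)
  | [u], c => opndPoly b N t u c
  | u :: v :: us, c =>
      ∑ j, ∑ l, (b.repr (b j * b l) c) • (opndPoly b N t u j * prodPoly t (v :: us) l)

/-- Coordinate `c` of the value of gate `g` (placed at position `t`), as a polynomial in the
original variables and the fresh variables of the earlier gates. [folklore] -/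
def gatePoly (t : ℕ) : Gate R σ → ι → MvPolynomial (σ ⊕ (Fin N × ι)) k
  | .sum args, c => (args.map fun a => ∑ l, (b.repr (a.1 * b l) c) • opndPoly b N t a.2 l).sum
  | .prod args, c => prodPoly b N t args c

/-- Reading the fresh variables against a list of gate values over `R`:
`y_{j,c} ↦` coordinate `c` of `vals[j]` (`0` out of range), `X x ↦ X x`. [folklore] -/
def readAt (vals : List (MvPolynomial σ R)) :
    MvPolynomial (σ ⊕ (Fin N × ι)) k →ₐ[k] MvPolynomial σ k :=
  aeval (Sum.elim X fun p : Fin N × ι => lmap (b.coord p.2) (vals.getD (p.1 : ℕ) 0))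

/-- The substitution eliminating the fresh variables of gate `t`:
`y_{t,c} ↦ gatePoly t g c`, all other variables fixed. [folklore] -/
def substGate (t : ℕ) (g : Gate R σ) :
    MvPolynomial (σ ⊕ (Fin N × ι)) k →ₐ[k] MvPolynomial (σ ⊕ (Fin N × ι)) k :=
  aeval (Sum.elim (fun x => X (Sum.inl x))
    fun p : Fin N × ι => if (p.1 : ℕ) = t then gatePoly b N t g p.2 else X (Sum.inr p))

/-- The composite substitution for a list of gates starting at position `t`:
`substGate t g₀ ∘ substGate (t+1) g₁ ∘ ⋯` (the LAST gate is substituted first). [folklore] -/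
def substGates : ℕ → List (Gate R σ) →
    (MvPolynomial (σ ⊕ (Fin N × ι)) k →ₐ[k] MvPolynomial (σ ⊕ (Fin N × ι)) k)
  | _, [] => AlgHom.id k _
  | t, g :: gs => (substGate b N t g).comp (substGates (t + 1) gs)

/-! #### Semantics -/

omit [Fintype ι] in
/-- `readAt` fixes the original variables. [folklore] -/
@[simp] theorem readAt_X_inl (vals : List (MvPolynomial σ R)) (x : σ) :
    readAt b N vals (X (Sum.inl x)) = X x := by
  simp [readAt]

omit [Fintype ι] in
/-- `readAt` reads coordinate `c` of `vals[j]` at `y_{j,c}`. [folklore] -/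
@[simp] theorem readAt_X_inr (vals : List (MvPolynomial σ R)) (p : Fin N × ι) :
    readAt b N vals (X (Sum.inr p)) = lmap (b.coord p.2) (vals.getD (p.1 : ℕ) 0) := by
  simp [readAt]

omit [Fintype ι] in
/-- Reading an operand polynomial at stage `t = vals.length` gives the coordinate of the
operand's value. [folklore] -/
theorem readAt_opndPoly (vals : List (MvPolynomial σ R)) (hN : vals.length ≤ N)
    (u : Operand R σ) (c : ι) :
    readAt b N vals (opndPoly b N vals.length u c) = lmap (b.coord c) (u.eval vals) := by
  cases u with
  | var x => simp [opndPoly, Operand.eval, lmap_coord_X]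
  | const r =>
    simp only [opndPoly, Operand.eval, lmap_coord_C]
    exact aeval_C _ _
  | gate j =>
    simp only [opndPoly, Operand.eval]
    split_ifs with hj
    · simp [yv, hj.trans_le hN]
    · rw [map_zero, List.getD_eq_default _ _ (not_lt.mp hj), lmap_zero]

/-- Reading a product polynomial gives the coordinate of the product. [folklore] -/
theorem readAt_prodPoly (vals : List (MvPolynomial σ R)) (hN : vals.length ≤ N)
    (us : List (Operand R σ)) (c : ι) :
    readAt b N vals (prodPoly b N vals.length us c) =
      lmap (b.coord c) (us.map fun u => u.eval vals).prod := by
  induction us generalizing c with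
  | nil =>
    simp only [prodPoly, List.map_nil, List.prod_nil, lmap_coord_one]
    exact aeval_C _ _
  | cons u us ih =>
    cases us with
    | nil =>
      simp only [prodPoly, List.map_cons, List.map_nil, List.prod_cons, List.prod_nil, mul_one]
      exact readAt_opndPoly b N vals hN u c
    | cons v us =>
      simp only [prodPoly]
      rw [List.map_cons, List.prod_cons, lmap_coord_mul, map_sum]
      refine Finset.sum_congr rfl fun j _ => ?_
      rw [map_sum]
      refine Finset.sum_congr rfl fun l _ => ?_
      rw [map_smul, map_mul (readAt b N vals), readAt_opndPoly b N vals hN, ih]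

/-- Reading a gate polynomial gives the coordinate of the gate's value. [folklore] -/
theorem readAt_gatePoly (vals : List (MvPolynomial σ R)) (hN : vals.length ≤ N)
    (g : Gate R σ) (c : ι) :
    readAt b N vals (gatePoly b N vals.length g c) = lmap (b.coord c) (g.eval vals) := by
  cases g with
  | sum args =>
    simp only [gatePoly, Gate.eval]
    rw [map_list_sum, lmap_list_sum, List.map_map, List.map_map]
    congr 1
    refine List.map_congr_left fun a _ => ?_
    simp only [Function.comp_apply]
    rw [lmap_coord_smul, map_sum]
    refine Finset.sum_congr rfl fun l _ => ?_
    rw [map_smul, readAt_opndPoly b N vals hN]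
  | prod args =>
    simp only [gatePoly, Gate.eval]
    exact readAt_prodPoly b N vals hN args c

/-- Unfolding `substGates` on a snoc. [folklore] -/
theorem substGates_append_singleton (t : ℕ) (gs : List (Gate R σ)) (g : Gate R σ) :
    substGates b N t (gs ++ [g]) = (substGates b N t gs).comp (substGate b N (t + gs.length) g) := by
  induction gs generalizing t with
  | nil => simp [substGates]
  | cons g' gs ih =>
    simp only [List.cons_append, substGates, List.length_cons]
    rw [ih, AlgHom.comp_assoc]
    congr 2
    ring_nf

/-- One step: reading after substituting gate `t = vals.length` is reading against the extended
value list. [folklore] -/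
theorem readAt_comp_substGate (vals : List (MvPolynomial σ R)) (hN : vals.length < N)
    (g : Gate R σ) :
    (readAt b N vals).comp (substGate b N vals.length g) = readAt b N (vals ++ [g.eval vals]) := by
  refine MvPolynomial.algHom_ext fun v => ?_
  rcases v with x | ⟨j, c⟩
  · simp [substGate]
  · simp only [AlgHom.comp_apply, substGate, aeval_X, Sum.elim_inr, readAt_X_inr]
    split_ifs with hj
    · rw [readAt_gatePoly b N vals hN.le, hj, List.getD_append_right _ _ _ _ le_rfl, Nat.sub_self]
      simp
    · rw [readAt_X_inr]
      rcases lt_or_gt_of_ne hj with hlt | hgt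
      · rw [List.getD_append _ _ _ _ hlt]
      · rw [List.getD_eq_default _ _ hgt.le, List.getD_eq_default _ _ (by simp; omega)]

/-- **Semantics of the simulation**: substituting all gates and then killing the fresh variables
is the same as reading against the list of gate values. [folklore] -/
theorem readAt_nil_comp_substGates (gs : List (Gate R σ)) (hN : gs.length ≤ N) :
    (readAt b N []).comp (substGates b N 0 gs) = readAt b N (gateValues gs) := by
  induction gs using List.reverseRecOn with
  | nil => simp [substGates, gateValues]
  | append_singleton gs g ih =>
    rw [List.length_append, List.length_singleton] at hN
    rw [substGates_append_singleton, ← AlgHom.comp_assoc, ih (by omega), zero_add,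
      gateValues_append_singleton, ← gateValues_length (k := R) gs,
      readAt_comp_substGate b N _ (by rw [gateValues_length]; omega)]

end Circuit

/-! #### Cost -/

section Cost

open ArithCircuit

/-- `L(∑ l) ≤ ∑ L(lᵢ) + |l|` for a list sum (one addition gate per summand). [folklore] -/
theorem complexity_list_sum_le {τ : Type*} (l : List (MvPolynomial τ k)) :
    complexity l.sum ≤ (l.map complexity).sum + l.length := by
  induction l with
  | nil => simpa using complexity_C_holds (σ := τ) (0 : k)
  | cons a l ih =>
    rw [List.sum_cons, List.map_cons, List.sum_cons, List.length_cons]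
    calc complexity (a + l.sum) ≤ complexity a + complexity l.sum + 1 := complexity_add_le_holds _ _
      _ ≤ complexity a + ((l.map complexity).sum + l.length) + 1 := by gcongr
      _ = _ := by ring

/-- Variables are free (pointwise form of `complexity_X`). [folklore] -/
@[simp] theorem complexity_X_eq {τ : Type*} (i : τ) : complexity (X i : MvPolynomial τ k) = 0 :=
  complexity_X_holds i

/-- Constants are free (pointwise form of `complexity_C`). [folklore] -/
@[simp] theorem complexity_C_eq {τ : Type*} (a : k) : complexity (C a : MvPolynomial τ k) = 0 :=
  complexity_C_holds a

/-- The zero polynomial is free. [folklore] -/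
@[simp] theorem complexity_zero' {τ : Type*} : complexity (0 : MvPolynomial τ k) = 0 := by
  simpa using complexity_C_holds (σ := τ) (0 : k)

variable (N : ℕ)

omit [Fintype ι] in
/-- Fresh variables are free. [folklore] -/
theorem complexity_yv (j : ℕ) (c : ι) : complexity (yv (k := k) (σ := σ) N j c) = 0 := by
  unfold yv
  split_ifs
  · exact complexity_X_holds _
  · exact complexity_zero'

omit [Fintype ι] in
/-- An operand coordinate costs at most one gate. [folklore] -/
theorem complexity_opndPoly_le (t : ℕ) (u : Operand R σ) (c : ι) :
    complexity (opndPoly b N t u c) ≤ 1 := by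
  cases u with
  | var x =>
    refine (complexity_smul_le_holds _ _).trans ?_
    rw [complexity_X_eq]
  | const r =>
    rw [opndPoly, complexity_C_eq]
    exact Nat.zero_le _
  | gate j =>
    simp only [opndPoly]
    split_ifs
    · rw [complexity_yv]; exact Nat.zero_le _
    · rw [complexity_zero']; exact Nat.zero_le _

/-- A structure-constant combination `∑ l, s l • opndPoly … l` costs at most `3 |ι|`.
[folklore] -/
theorem complexity_sum_smul_opndPoly_le (t : ℕ) (u : Operand R σ) (s : ι → k) :
    complexity (∑ l, s l • opndPoly b N t u l) ≤ 3 * Fintype.card ι := by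
  calc complexity (∑ l, s l • opndPoly b N t u l)
      ≤ ∑ l, complexity (s l • opndPoly b N t u l) + (Finset.univ : Finset ι).card :=
        complexity_finset_sum_le _ _
    _ ≤ ∑ _l : ι, 2 + (Finset.univ : Finset ι).card := by
        gcongr with l
        exact (complexity_smul_le_holds _ _).trans
          (Nat.add_le_add_right (complexity_opndPoly_le b N t u l) 1)
    _ = 3 * Fintype.card ι := by simp [Finset.card_univ]; ring

/-- A product coordinate of fan-in `≤ 2` costs at most `5 |ι|² + |ι|`… precisely: length `0`
costs `0`, length `1` costs `≤ 1`, length `2` costs `≤ 5|ι|² + |ι|`. [folklore] -/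
theorem complexity_prodPoly_le (t : ℕ) (us : List (Operand R σ)) (hus : us.length ≤ 2) (c : ι) :
    complexity (prodPoly b N t us c) ≤ 5 * Fintype.card ι ^ 2 + Fintype.card ι := by
  match us, hus with
  | [], _ =>
    rw [prodPoly, complexity_C_eq]
    exact Nat.zero_le _
  | [u], _ =>
    rw [prodPoly]
    refine (complexity_opndPoly_le b N t u c).trans ?_
    have : 1 ≤ Fintype.card ι := Fintype.card_pos_iff.2 ⟨c⟩
    nlinarith
  | [u, v], _ =>
    rw [prodPoly]
    calc complexity (∑ j, ∑ l, (b.repr (b j * b l) c) •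
            (opndPoly b N t u j * prodPoly b N t [v] l))
        ≤ ∑ j, complexity (∑ l, (b.repr (b j * b l) c) •
            (opndPoly b N t u j * prodPoly b N t [v] l)) + (Finset.univ : Finset ι).card :=
          complexity_finset_sum_le _ _
      _ ≤ ∑ _j : ι, (5 * Fintype.card ι) + (Finset.univ : Finset ι).card := by
          gcongr with j
          calc complexity (∑ l, (b.repr (b j * b l) c) •
                  (opndPoly b N t u j * prodPoly b N t [v] l))
              ≤ ∑ l, complexity ((b.repr (b j * b l) c) •
                  (opndPoly b N t u j * prodPoly b N t [v] l)) + (Finset.univ : Finset ι).card :=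
                complexity_finset_sum_le _ _
            _ ≤ ∑ _l : ι, 4 + (Finset.univ : Finset ι).card := by
                gcongr with l
                refine (complexity_smul_le_holds _ _).trans ?_
                refine Nat.add_le_add_right ((complexity_mul_le_holds _ _).trans ?_) 1
                have h1 := complexity_opndPoly_le b N t u j
                have h2 : complexity (prodPoly b N t [v] l) ≤ 1 := by
                  rw [prodPoly]; exact complexity_opndPoly_le b N t v l
                omega
            _ = 5 * Fintype.card ι := by simp [Finset.card_univ]; ring
      _ = 5 * Fintype.card ι ^ 2 + Fintype.card ι := by simp [Finset.card_univ]; ring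
  | _ :: _ :: _ :: _, h => simp at h

/-- **Cost of one gate**: all `|ι|` coordinates of a fan-in-two gate together cost at most
`5|ι|³ + 6|ι|² + 2|ι|` gates over `k`. [folklore] -/
theorem sum_complexity_gatePoly_le (t : ℕ) (g : Gate R σ) (hg : g.fanIn ≤ 2) :
    ∑ c, complexity (gatePoly b N t g c) ≤
      5 * Fintype.card ι ^ 3 + 6 * Fintype.card ι ^ 2 + 2 * Fintype.card ι := by
  cases g with
  | sum args =>
    have hlen : args.length ≤ 2 := by simpa [Gate.fanIn, Gate.args] using hg
    calc ∑ c, complexity (gatePoly b N t (.sum args) c)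
        ≤ ∑ _c : ι, (6 * Fintype.card ι + 2) := by
          gcongr with c
          rw [gatePoly]
          refine (complexity_list_sum_le _).trans ?_
          rw [List.map_map, List.length_map]
          have hsum : (args.map (complexity ∘ fun a =>
              ∑ l, (b.repr (a.1 * b l) c) • opndPoly b N t a.2 l)).sum ≤
              args.length * (3 * Fintype.card ι) := by
            have := List.sum_le_card_nsmul (args.map (complexity ∘ fun a =>
              ∑ l, (b.repr (a.1 * b l) c) • opndPoly b N t a.2 l)) (3 * Fintype.card ι)
              (fun x hx => by
                simp only [List.mem_map, Function.comp_apply] at hx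
                obtain ⟨a, _, rfl⟩ := hx
                exact complexity_sum_smul_opndPoly_le b N t a.2 _)
            simpa using this
          calc _ ≤ args.length * (3 * Fintype.card ι) + args.length := Nat.add_le_add_right hsum _
            _ ≤ 2 * (3 * Fintype.card ι) + 2 := by gcongr
            _ = 6 * Fintype.card ι + 2 := by ring
      _ = 6 * Fintype.card ι ^ 2 + 2 * Fintype.card ι := by simp [Finset.card_univ]; ring
      _ ≤ _ := by omega
  | prod args =>
    have hlen : args.length ≤ 2 := by simpa [Gate.fanIn, Gate.args] using hg
    calc ∑ c, complexity (gatePoly b N t (.prod args) c)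
        ≤ ∑ _c : ι, (5 * Fintype.card ι ^ 2 + Fintype.card ι) := by
          gcongr with c
          rw [gatePoly]
          exact complexity_prodPoly_le b N t args hlen c
      _ = 5 * Fintype.card ι ^ 3 + Fintype.card ι ^ 2 := by simp [Finset.card_univ]; ring
      _ ≤ _ := by nlinarith

variable [Fintype σ]

/-- A sum over `Fin N` of a quantity supported on `(j : ℕ) = t` is at most that quantity.
[folklore] -/
theorem sum_fin_ite_val_eq_le (t A : ℕ) :
    (∑ j : Fin N, if (j : ℕ) = t then A else 0) ≤ A := by
  by_cases ht : t < N
  · rw [Finset.sum_eq_single ⟨t, ht⟩]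
    · simp
    · intro j _ hj
      rw [if_neg]
      exact fun h => hj (Fin.ext h)
    · simp
  · rw [Finset.sum_eq_zero]
    · exact Nat.zero_le _
    · intro j _
      rw [if_neg]
      omega

/-- **Cost of one substitution step** (Bürgisser's substitution bound): eliminating the fresh
variables of gate `t` costs at most the cost of its `|ι|` coordinate polynomials. [folklore] -/
theorem complexity_substGate_le (t : ℕ) (g : Gate R σ) (H : MvPolynomial (σ ⊕ (Fin N × ι)) k) :
    complexity (substGate b N t g H) ≤ complexity H + ∑ c, complexity (gatePoly b N t g c) := by
  rw [substGate]
  refine (complexity_aeval_le _ _).trans (Nat.add_le_add_left ?_ _)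
  rw [Fintype.sum_sum_type, Fintype.sum_prod_type]
  simp only [Sum.elim_inl, Sum.elim_inr, complexity_X_eq, Finset.sum_const_zero, zero_add,
    apply_ite complexity]
  rw [Finset.sum_comm]
  gcongr with c
  exact sum_fin_ite_val_eq_le N t _

/-- **Cost of the whole simulation**: `|gs| · (5|ι|³ + 6|ι|² + 2|ι|)` on top of the cost of the
polynomial being substituted into. [folklore] -/
theorem complexity_substGates_le (gs : List (Gate R σ)) (hfan : ∀ g ∈ gs, g.fanIn ≤ 2) (t : ℕ)
    (H : MvPolynomial (σ ⊕ (Fin N × ι)) k) :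
    complexity (substGates b N t gs H) ≤ complexity H +
      gs.length * (5 * Fintype.card ι ^ 3 + 6 * Fintype.card ι ^ 2 + 2 * Fintype.card ι) := by
  induction gs generalizing t with
  | nil => simp [substGates]
  | cons g gs ih =>
    rw [substGates, AlgHom.comp_apply, List.length_cons]
    have hg : g.fanIn ≤ 2 := hfan g (by simp)
    have ih' := ih (fun g' hg' => hfan g' (by simp [hg'])) (t + 1)
    calc complexity (substGate b N t g (substGates b N (t + 1) gs H))
        ≤ complexity (substGates b N (t + 1) gs H) + ∑ c, complexity (gatePoly b N t g c) :=
          complexity_substGate_le b N t g _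
      _ ≤ (complexity H + gs.length *
            (5 * Fintype.card ι ^ 3 + 6 * Fintype.card ι ^ 2 + 2 * Fintype.card ι)) +
            (5 * Fintype.card ι ^ 3 + 6 * Fintype.card ι ^ 2 + 2 * Fintype.card ι) :=
          Nat.add_le_add ih' (sum_complexity_gatePoly_le b N t g hg)
      _ = _ := by ring

/-- Killing the fresh variables is free. [folklore] -/
theorem complexity_readAt_nil_le (H : MvPolynomial (σ ⊕ (Fin N × ι)) k) :
    complexity (readAt b N [] H) ≤ complexity H := by
  rw [readAt]
  refine (complexity_aeval_le _ _).trans (le_of_eq ?_)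
  rw [Fintype.sum_sum_type]
  simp

end Cost

/-! ### The simulation theorem -/

section Main

open ArithCircuit

variable [Fintype σ]

/-- The output polynomial: `φ` of the output operand, in coordinates. [folklore] -/
def outPoly (P : ArithCircuit R σ) (φ : R →ₗ[k] k) : MvPolynomial (σ ⊕ (Fin P.size × ι)) k :=
  ∑ c, φ (b c) • opndPoly b P.size P.size P.output c

/-- The simulating polynomial of a circuit `P` over `R`, read through `φ`. [folklore] -/
def simPoly (P : ArithCircuit R σ) (φ : R →ₗ[k] k) : MvPolynomial σ k :=
  readAt b P.size [] (substGates b P.size 0 P.gates (outPoly b P φ))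

omit [Fintype σ] in
/-- **Correctness**: the simulating polynomial is `φ` applied coefficientwise to the polynomial
computed by `P`. [folklore] -/
theorem simPoly_eq (P : ArithCircuit R σ) (φ : R →ₗ[k] k) : simPoly b P φ = lmap φ P.eval := by
  rw [simPoly, ← AlgHom.comp_apply, readAt_nil_comp_substGates b P.size P.gates le_rfl, outPoly,
    map_sum, lmap_eq_sum_coord b φ P.eval]
  refine Finset.sum_congr rfl fun c _ => ?_
  rw [map_smul, ArithCircuit.eval]
  congr 1
  have hlen : (gateValues P.gates).length = P.size := gateValues_length (k := R) P.gates
  have h := readAt_opndPoly b P.size (gateValues P.gates) hlen.le P.output c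
  rwa [hlen] at h

/-- **Cost**: `L_k(simPoly) ≤ 3|ι| + |P| · (5|ι|³ + 6|ι|² + 2|ι|)` for fan-in-two `P`. [folklore] -/
theorem complexity_simPoly_le (P : ArithCircuit R σ) (hP : P.IsFanInTwo) (φ : R →ₗ[k] k) :
    complexity (simPoly b P φ) ≤ 3 * Fintype.card ι +
      P.size * (5 * Fintype.card ι ^ 3 + 6 * Fintype.card ι ^ 2 + 2 * Fintype.card ι) := by
  rw [simPoly]
  refine (complexity_readAt_nil_le b P.size _).trans ?_
  refine (complexity_substGates_le b P.size P.gates hP 0 _).trans ?_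
  refine Nat.add_le_add_right ?_ _
  rw [outPoly]
  calc complexity (∑ c, φ (b c) • opndPoly b P.size P.size P.output c)
      ≤ ∑ c, complexity (φ (b c) • opndPoly b P.size P.size P.output c) +
          (Finset.univ : Finset ι).card := complexity_finset_sum_le _ _
    _ ≤ ∑ _c : ι, 2 + (Finset.univ : Finset ι).card := by
        gcongr with c
        exact (complexity_smul_le_holds _ _).trans
          (Nat.add_le_add_right (complexity_opndPoly_le b _ _ _ c) 1)
    _ = 3 * Fintype.card ι := by simp [Finset.card_univ]; ring

/-- **Simulating a commutative coefficient algebra** (Hrubeš–Yehudayoff 2011, Thm 4.2, in the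
commutative case and up to polynomial factors): if `R` is a commutative `k`-algebra with a finite
basis `b : ι → R`, then for every `F : MvPolynomial σ R` and every `k`-linear functional `φ`,
the polynomial `φ(F)` obtained by applying `φ` coefficientwise satisfies
`L_k(φ(F)) ≤ (5|ι|³ + 6|ι|² + 2|ι|) · L_R(F) + 3|ι|`. [cite: HrubesYehudayoff2011, Thm 4.2] -/
theorem complexity_lmap_le (b : Module.Basis ι k R) (φ : R →ₗ[k] k) (F : MvPolynomial σ R) :
    complexity (lmap φ F) ≤
      (5 * Fintype.card ι ^ 3 + 6 * Fintype.card ι ^ 2 + 2 * Fintype.card ι) * complexity F +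
        3 * Fintype.card ι := by
  obtain ⟨P, hP1, hP2, hP3⟩ := exists_computes_size_eq_complexity F
  rw [Computes] at hP2
  have h1 := complexity_simPoly_le b P hP1 φ
  rw [simPoly_eq, hP2, hP3] at h1
  refine h1.trans (le_of_eq ?_)
  ring

end Main

end CommExtSim

end Literature.Computability.AlgebraicComplexity
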